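import Literature.Topology.FourManifolds.FiveChainLoopSurgery
import Literature.Topology.FourManifolds.DependentTripleGenusThreeTrisectionsProofs
import Literature.Topology.FourManifolds.HomotopyS4OrientableProofs

/-!
# Crux `WeakReductionDescent.DependentTripleGenusThreeStandard` (stmt-SmoothPoincare4-18000), line
# `Sketch`, skeleton v12: the pants case from a slide lemma and the five-chain surgery fact

Reduction glue for the registered skeleton v12 of the crux (`Cruxes/…/Lines/Sketch.lean`), filed
`--supports stmt-SmoothPoincare4-18000` (registered helper
`helper_loopPartnerOfDuals_of_fiveChain_of_surgery`).  PROVED.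

v12 isolates everything `4`-dimensional or `3`-dimensional of Aranda–Zupan's proof of Thm 1.4
(arXiv:2503.04607, §7) in NAMED LITERATURE FACTS — Thm 1.3 (hs), Meier–Schirmer–Zupan, Lemma 3.8
and Lemma 3.7 on genus-three spines, and five-chain surgery (Lemma 5.4 + Prop. 5.5,
`Literature.Topology.FourManifolds.arandaZupan_fiveChain_loopSurgery_gk`, p173602) — leaving as
the one open stub a SLIDE LEMMA on the genus-three central surface: a pants-type triple with the
duals Lemma 3.7 supplies carries a concrete five-chain centred at a cuff (pp. 25–26, Fig. 19).
This file proves that the slide lemma and the five-chain surgery fact give v11's apex (pants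
triple + duals ⇒ loop partner of genus `≤ 2`): the pants clause of the five-chain is the
pants-type hypothesis on the triple, `M ≃ₕ S⁴` is orientable, `k = (1,1,1)`.

References: R. Aranda, A. Zupan, arXiv:2503.04607 (2025), §5 (pp. 18–20), §7 (pp. 25–26).
-/

noncomputable section

set_option linter.dupNamespace false

open scoped Manifold ContDiff Topology ContinuousMap
open Set
open Literature.Topology.FourManifolds
open Literature.Topology.FourManifolds.Trisection

namespace Summit.SmoothPoincare4.SmoothPoincare4.Theorems

/-- **The pants case of Aranda–Zupan's §7 from the slide lemma and five-chain surgery** (PROVED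
glue; registered helper of crux stmt-SmoothPoincare4-18000, line `Sketch`, skeleton v12: stubs
4b-i + 4c ⟹ v11's stub 4b).  Hypotheses: `hS` — on a `(3; k)`-trisected `M`, a pants-type triple
`f` with a dual for every ordered pair of cuffs carries a concrete five-chain centred at some cuff
`f p` (neighbours `nj ⊂ H_j`, `nl ⊂ H_l` compressing, `nj ∩ nl = nj ∩ f j = nl ∩ f l = ∅`, `nj`,
`nl` meeting `f p` once transversally, `nj` meeting `f l` and `nl` meeting `f j` once
transversally); `hC` — five-chain surgery (`arandaZupan_fiveChain_loopSurgery_gk`).  Conclusion: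
a `(3;1,1,1)`-trisected `M ≃ₕ S⁴` with such a triple (not weakly reducible, duals for every pair)
is a circle surgery on a loop of a smooth `X′` GK-trisected in genus `≤ 2`.  Proof: the pants
clause of the five-chain (`f p, f j, f l` pairwise mutually non-separating, jointly separating) is
the pants-type hypothesis (`⋃ i, f i = f p ∪ f j ∪ f l`); `M` is orientable
(`isOrientable_of_homotopyEquiv_sphere_four_holds`); apply `hC` with `k = (1,1,1)`.
[cite: ArandaZupan2025, §7 (p. 25, "It follows from Lemma 5.4 and Proposition 5.5 that `X` is obtained by surgery on a loop …")] -/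
theorem helper_loopPartnerOfDuals_of_fiveChain_of_surgery :
    (∀ (M : Type) [TopologicalSpace M] [T2Space M] [SecondCountableTopology M]
      [ChartedSpace (EuclideanSpace ℝ (Fin 4)) M] [IsManifold (𝓡 4) ∞ M],
      ∀ (k : Fin 3 → ℕ) (T : Fin 3 → Set M), IsGKTrisection M 3 k T →
      ∀ f : Fin 3 → Set M,
      ((∀ i, IsCurve T (f i)) ∧ (Pairwise fun i j => Disjoint (f i) (f j)) ∧
        (∀ i, IsNonSeparating T (f i)) ∧ (∀ i, BoundsDisc T (spineHandlebody T i) (f i)) ∧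
        (∀ i j, i ≠ j → IsConnected (centralSurfaceSet T \ (f i ∪ f j))) ∧
        ¬ IsPreconnected (centralSurfaceSet T \ ⋃ i, f i)) →
      (∀ i j : Fin 3, i ≠ j →
        (∃ y' : Set M, IsCurve T y' ∧ BoundsDisc T (spineHandlebody T j) y' ∧
          MeetsOnceTransv y' (f i) ∧ Disjoint y' (f j)) ∨
        (∃ x' : Set M, IsCurve T x' ∧ BoundsDisc T (spineHandlebody T i) x' ∧
          MeetsOnceTransv x' (f j) ∧ Disjoint x' (f i))) →
      ∃ (p j l : Fin 3) (nj nl : Set M), p ≠ j ∧ p ≠ l ∧ j ≠ l ∧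
        IsCurve T nj ∧ IsCurve T nl ∧
        BoundsDisc T (spineHandlebody T j) nj ∧ BoundsDisc T (spineHandlebody T l) nl ∧
        Disjoint nj nl ∧ Disjoint nj (f j) ∧ Disjoint nl (f l) ∧
        MeetsOnceTransv nj (f p) ∧ MeetsOnceTransv nl (f p) ∧
        MeetsOnceTransv nj (f l) ∧ MeetsOnceTransv nl (f j)) →
    arandaZupan_fiveChain_loopSurgery_gk.{0} →
    ∀ (M : Type) [TopologicalSpace M] [T2Space M] [SecondCountableTopology M]
      [ChartedSpace (EuclideanSpace ℝ (Fin 4)) M] [IsManifold (𝓡 4) ∞ M],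
      M ≃ₕ (Metric.sphere (0 : EuclideanSpace ℝ (Fin 5)) 1) → ∀ T : Fin 3 → Set M,
      IsGKTrisection M 3 (fun _ => 1) T →
      ∀ f : Fin 3 → Set M,
      ((∀ i, IsCurve T (f i)) ∧ (Pairwise fun i j => Disjoint (f i) (f j)) ∧
        (∀ i, IsNonSeparating T (f i)) ∧ (∀ i, BoundsDisc T (spineHandlebody T i) (f i)) ∧
        (∀ i j, i ≠ j → IsConnected (centralSurfaceSet T \ (f i ∪ f j))) ∧
        ¬ IsPreconnected (centralSurfaceSet T \ ⋃ i, f i)) →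
      ¬ IsWeaklyReducible T →
      (∀ i j : Fin 3, i ≠ j →
        (∃ y' : Set M, IsCurve T y' ∧ BoundsDisc T (spineHandlebody T j) y' ∧
          MeetsOnceTransv y' (f i) ∧ Disjoint y' (f j)) ∨
        (∃ x' : Set M, IsCurve T x' ∧ BoundsDisc T (spineHandlebody T i) x' ∧
          MeetsOnceTransv x' (f j) ∧ Disjoint x' (f i))) →
      ∃ (X' : Type) (_ : TopologicalSpace X') (_ : T2Space X') (_ : SecondCountableTopology X')
        (_ : ChartedSpace (EuclideanSpace ℝ (Fin 4)) X') (_ : IsManifold (𝓡 4) ∞ X')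
        (g' : ℕ) (k' : Fin 3 → ℕ) (T' : Fin 3 → Set X')
        (ℓ : Metric.sphere (0 : EuclideanSpace ℝ (Fin 2)) 1 → X'),
        g' ≤ 2 ∧ IsGKTrisection X' g' k' T' ∧ IsCircleSurgery (𝓡 4) (𝓡 4) X' M ℓ := by
  intro hS hC M _ _ _ _ _ e T hT f hf _hwr hduals
  obtain ⟨hcur, hdis, hns, hbd, hconn, hdep⟩ := hf
  obtain ⟨p, j, l, nj, nl, hpj, hpl, hjl, hcnj, hcnl, hbnj, hbnl, hnjnl, hnjfj, hnlfl,
    hnjc, hnlc, hnjel, hnlej⟩ := hS M (fun _ => 1) T hT f ⟨hcur, hdis, hns, hbd, hconn, hdep⟩ hduals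
  have hM : IsOrientable (𝓡 4) M := isOrientable_of_homotopyEquiv_sphere_four_holds M e
  -- the pants clause for centre `f p` and ends `f j`, `f l`
  have hU : centralSurfaceSet T \ (f p ∪ f j ∪ f l) = centralSurfaceSet T \ ⋃ i, f i := by
    have key : ∀ p j l i : Fin 3, p ≠ j → p ≠ l → j ≠ l → i = p ∨ i = j ∨ i = l := by decide
    congr 1
    apply le_antisymm
    · exact union_subset (union_subset (subset_iUnion f p) (subset_iUnion f j)) (subset_iUnion f l)
    · exact iUnion_subset fun i => by
        rcases key p j l i hpj hpl hjl with rfl | rfl | rfl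
        · exact subset_union_left.trans subset_union_left
        · exact subset_union_right.trans subset_union_left
        · exact subset_union_right
  have hdep' : ¬ IsPreconnected (centralSurfaceSet T \ (f p ∪ f j ∪ f l)) := by rwa [hU]
  obtain ⟨X', i₁, i₂, i₃, i₄, i₅, k', T', ℓ, hT', hs⟩ := hC M hM (fun _ => 1) T hT (fun _ => le_rfl)
    p j l hpj hpl hjl (f p) (f j) (f l) nj nl (hcur p) (hcur j) (hcur l) hcnj hcnl
    (hbd p) (hbd j) (hbd l) hbnj hbnl (hdis hpj) (hdis hpl) (hdis hjl) (hns p) (hns j) (hns l)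
    (hconn p j hpj) (hconn p l hpl) (hconn j l hjl) hdep' hnjnl hnjfj hnlfl hnjc hnlc hnjel hnlej
  exact ⟨X', i₁, i₂, i₃, i₄, i₅, 2, k', T', ℓ, le_rfl, hT', hs⟩

end Summit.SmoothPoincare4.SmoothPoincare4.Theorems

end
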